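import Summits.FinalStateConjecture.FinalStateConjecture.Theorems.ClusterCompletenessOmegaLimitMultiKerrDefs
import Literature.Geometry.Lorentzian.RecedingKerrInitialLayerNorm
import HarnessLib

/-!
# Route ClusterCompleteness · crux `LinearToNonlinearCapture` — posited interface of line
# `incoming-from-the-past` (D-0016 `<Route>Defs` convention)

The STABLE vocabulary over which the registered stubs of line `incoming-from-the-past` of the crux
stmt-FinalStateConjecture-14526 (`ClusterCompleteness.LinearToNonlinearCapture :=
AdiabaticMultiKerrILED → RecurrentMultiKerrCapture`, rank 3) are stated, moved VERBATIM out of the crux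
workfile `Cruxes/LinearToNonlinearCapture/Lines/incoming_from_the_past.lean` §"Interface predicates"
(planner `planner-cruxplan-stmt-FinalStateConjecture-14526-incoming-from-the-pa-0`, 2026-08-16; the line
card's step 0 for the lead) so that stub proofs under `Theorems/` and the skeleton import ONE copy. The only
textual change is the name of the local clause-(11) predicate, `Recurs` ↦ `RecurClause`, to avoid a clash
with the landed matrix `ClusterCompleteness.Recurs k 𝒟` of `ClusterCompletenessOmegaLimitMultiKerrDefs`
(no registered stub signature mentions it).

* `Frame` — clauses (1)–(10) of the hypothesis of the route target X (`RecurrentMultiKerrCapture`),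
  verbatim, charts as parameters; `RecurClause k` — clause (11) verbatim; `Hyp k 𝒟 N` — X's hypothesis
  at order `k` with the hole count `N` explicit (read-back `recurs_iff_exists_hyp : Recurs k 𝒟 ↔ ∃ N,
  Hyp k 𝒟 N`, re-bracketing only);
* `CollarRecurs` / `HypCollar` — recurrence out to the tube radius `max R′ (ρᵢ τ + R′)`;
* `Window` / `HypW` — windowed recurrence on `[τ, τ + T]` in a re-chosen witness tuple;
* `labPos`, `refForm`, `shellFlux`, `flatDev`, `holeDev`, `farFlux`, `HypL` — the far-shell flux of the
  atlas through the outgoing hyperboloidal layer of `RecedingKerr.layer/farLayer/background` with the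
  Dafermos–Rodnianski `r^p` / `r^{-1-δ}` flux functionals `RecedingKerr.rpFlux/transversalFlux`, and the
  manufactured LAYER-smallness hypothesis;
* `SettlesExt` — the decomposition conjunct of X's conclusion, verbatim (`Settles = CNI ∧ SettlesExt`,
  `settles_iff_cni_and_settlesExt`).

Plus the sorry-free tightness lemmas of the skeleton (`hyp_mono`, `hyp_of_hypCollar`, `hyp_of_hypW`,
`hyp_of_hypL`), moved here so that stub files can use them. Everything is a definition or a re-bracketing
over EXISTING declarations; nothing restates a route item under a new name (`Hyp` is certified to be X's
hypothesis by `recurs_iff_exists_hyp`). This module does not import the route file.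
-/

-- every `Summit.FinalStateConjecture.FinalStateConjecture.…` name repeats the summit = sub-problem segment (D-0017 layout)
set_option linter.dupNamespace false

noncomputable section

open scoped BigOperators Topology Manifold ENNReal ContDiff
open Filter Set Function TopologicalSpace MeasureTheory

namespace Summit.FinalStateConjecture.FinalStateConjecture.Theorems.ClusterCompleteness.IncomingFromThePast

open Literature.Geometry.Lorentzian

section Interface

variable {X : Type} [TopologicalSpace X] [ChartedSpace E3 X] [IsManifold (𝓡 3) ∞ X]
  [ConnectedSpace X] {D : InitialDataSet (𝓡 3) X}

/-- `Frame`: clauses (1)–(10) of the hypothesis of `RecurrentMultiKerrCapture`, VERBATIM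
(sub-extremal labels; hole late charts; flat late chart; sublinear tubes; `Rᵢ → ∞`; the flat
domain contains the late half-space minus the label tubes; separation for every radius;
`O = exteriorOf(charted)`; exhaustion for every `τ₁ > τ₀`; the uniform `C⁰` anchor). [cite: DafermosLuk2017, §1.2.1] -/
def Frame (𝒟 : VacuumCauchyDevelopment D) (O : Set 𝒟.carrier) {N : ℕ} (M a : Fin N → ℝ)
    (mo : Fin N → lorentzGroup × E4) (τ₀ : ℝ)
    (Ψ : ∀ i, boostedKerrExterior (mo i).1 (mo i).2 (M i) (a i) → 𝒟.carrier)
    (ρ R : Fin N → ℝ → ℝ) (U₀ : Opens E4) (Ψ₀ : U₀ → 𝒟.carrier) : Prop :=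
  (∀ i, Kerr.IsSubextremal (M i) (a i)) ∧
  (∀ i, 𝒟.toSpacetime.IsLateChart
    (boostedKerrBackground (mo i).1 (mo i).2 (M i) (a i)) O τ₀ (Ψ i)) ∧
  𝒟.toSpacetime.IsLateChart (Minkowski.backgroundOn U₀) O τ₀ Ψ₀ ∧
  (∀ i, Tendsto (fun t ↦ ρ i t / t) atTop (𝓝 0)) ∧
  (∀ i, Tendsto (R i) atTop atTop) ∧
  {x : E4 | τ₀ < x 0 ∧
    ∀ i, ρ i (x 0) < Kerr.radius (a i) (poincareInv (mo i).1 (mo i).2 x)} ⊆ (U₀ : Set E4) ∧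
  (∀ R' : ℝ, ∃ τ₁ : ℝ, Pairwise (Function.onFun Disjoint fun i ↦
    Ψ i '' (boostedKerrBackground (mo i).1 (mo i).2 (M i) (a i)).truncLateRegion τ₁ R')) ∧
  O = Summit.FinalStateConjecture.exteriorOf 𝒟.toCauchyDevelopment
    ((⋃ i, Ψ i '' (boostedKerrBackground (mo i).1 (mo i).2 (M i) (a i)).lateRegion τ₀) ∪
      Ψ₀ '' (Minkowski.backgroundOn U₀).lateRegion τ₀) ∧
  (∀ τ₁ : ℝ, τ₀ < τ₁ →
    O \ (Ψ₀ '' (Minkowski.backgroundOn U₀).lateRegion τ₁ ∪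
      ⋃ i, Ψ i '' {x | τ₁ < (boostedKerrBackground (mo i).1 (mo i).2 (M i) (a i)).time x.1 ∧
        (boostedKerrBackground (mo i).1 (mo i).2 (M i) (a i)).radius x.1 ≤
          R i ((boostedKerrBackground (mo i).1 (mo i).2 (M i) (a i)).time x.1)}) ⊆
    𝒟.metric.causalPast 𝒟.timeOrientation
      (Ψ₀ '' (Minkowski.backgroundOn U₀).timeSlab τ₁ ∪
        ⋃ i, Ψ i '' (boostedKerrBackground (mo i).1 (mo i).2 (M i) (a i)).truncTimeSlab
          (R i τ₁) τ₁)) ∧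
  (∀ τ : ℝ, τ₀ < τ →
    𝒟.toSpacetime.deviationCk (Minkowski.backgroundOn U₀) Ψ₀ 0 τ ≤ ENNReal.ofReal (1 / 4) ∧
      ∀ i, 𝒟.toSpacetime.truncDeviationCk
        (boostedKerrBackground (mo i).1 (mo i).2 (M i) (a i)) (Ψ i) 0 (R i τ) τ ≤
          ENNReal.ofReal (1 / 4))

/-- `RecurClause k`: clause (11) of the hypothesis of `RecurrentMultiKerrCapture`, VERBATIM — `Cᵏ`
`ε`-closeness recurs at arbitrarily late chart times, on whole flat slabs and out to every
FIXED near-zone radius `R′`. [cite: DafermosLuk2017, §1.2.1] -/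
def RecurClause (𝒟 : VacuumCauchyDevelopment D) {N : ℕ} (M a : Fin N → ℝ)
    (mo : Fin N → lorentzGroup × E4)
    (Ψ : ∀ i, boostedKerrExterior (mo i).1 (mo i).2 (M i) (a i) → 𝒟.carrier)
    (U₀ : Opens E4) (Ψ₀ : U₀ → 𝒟.carrier) (k : ℕ) : Prop :=
  ∀ R' : ℝ, ∀ ε : ℝ, 0 < ε → ∃ᶠ τ in atTop,
    𝒟.toSpacetime.deviationCk (Minkowski.backgroundOn U₀) Ψ₀ k τ ≤ ENNReal.ofReal ε ∧
      ∀ i, 𝒟.toSpacetime.truncDeviationCk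
        (boostedKerrBackground (mo i).1 (mo i).2 (M i) (a i)) (Ψ i) k R' τ ≤
          ENNReal.ofReal ε

/-- `Hyp k 𝒟 N`: the hypothesis of `RecurrentMultiKerrCapture` at order `k` with the hole count
`N` made explicit (`Frame ∧ RecurClause k` over the existential witness tuple). [cite: DafermosLuk2017, §1.2.1] -/
def Hyp (k : ℕ) (𝒟 : VacuumCauchyDevelopment D) (N : ℕ) : Prop :=
  ∃ (O : Set 𝒟.carrier) (M a : Fin N → ℝ) (mo : Fin N → lorentzGroup × E4) (τ₀ : ℝ)
    (Ψ : ∀ i, boostedKerrExterior (mo i).1 (mo i).2 (M i) (a i) → 𝒟.carrier)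
    (ρ R : Fin N → ℝ → ℝ) (U₀ : Opens E4) (Ψ₀ : U₀ → 𝒟.carrier),
    Frame 𝒟 O M a mo τ₀ Ψ ρ R U₀ Ψ₀ ∧ RecurClause 𝒟 M a mo Ψ U₀ Ψ₀ k

/-- `CollarRecurs k`: clause (11) with the hole charts' recurrence radius raised from the fixed
`R′` to `ρᵢ(τ) + R′` — the label collar `{R′ < rᵢ < ρᵢ(τ)}` between the certified fixed-radius
near zone and the flat chart's guaranteed domain is recurrently `Cᵏ`-clean as well. [cite: DafermosLuk2017, §1.2.1] -/
def CollarRecurs (𝒟 : VacuumCauchyDevelopment D) {N : ℕ} (M a : Fin N → ℝ)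
    (mo : Fin N → lorentzGroup × E4)
    (Ψ : ∀ i, boostedKerrExterior (mo i).1 (mo i).2 (M i) (a i) → 𝒟.carrier)
    (ρ : Fin N → ℝ → ℝ) (U₀ : Opens E4) (Ψ₀ : U₀ → 𝒟.carrier) (k : ℕ) : Prop :=
  ∀ R' : ℝ, ∀ ε : ℝ, 0 < ε → ∃ᶠ τ in atTop,
    𝒟.toSpacetime.deviationCk (Minkowski.backgroundOn U₀) Ψ₀ k τ ≤ ENNReal.ofReal ε ∧
      ∀ i, 𝒟.toSpacetime.truncDeviationCk
        (boostedKerrBackground (mo i).1 (mo i).2 (M i) (a i)) (Ψ i) k (max R' (ρ i τ + R')) τ ≤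
          ENNReal.ofReal ε

/-- `HypCollar k 𝒟 N`: `Frame ∧ CollarRecurs k` over a (re-chosen) witness tuple. [cite: DafermosLuk2017, §1.2.1] -/
def HypCollar (k : ℕ) (𝒟 : VacuumCauchyDevelopment D) (N : ℕ) : Prop :=
  ∃ (O : Set 𝒟.carrier) (M a : Fin N → ℝ) (mo : Fin N → lorentzGroup × E4) (τ₀ : ℝ)
    (Ψ : ∀ i, boostedKerrExterior (mo i).1 (mo i).2 (M i) (a i) → 𝒟.carrier)
    (ρ R : Fin N → ℝ → ℝ) (U₀ : Opens E4) (Ψ₀ : U₀ → 𝒟.carrier),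
    Frame 𝒟 O M a mo τ₀ Ψ ρ R U₀ Ψ₀ ∧ CollarRecurs 𝒟 M a mo Ψ ρ U₀ Ψ₀ k

/-- `Window k … ε R′ T τ`: `Cᵏ` `ε`-closeness holds on the whole chart-time window
`[τ, τ + T]` — the flat chart on its whole slabs, hole chart `i` out to radius
`ρᵢ(τ + T) + R′` (which, `ρᵢ` being monotone in the re-chosen tuple, covers the label tube
throughout the window). [cite: arXiv210408222, §1] -/
def Window (𝒟 : VacuumCauchyDevelopment D) {N : ℕ} (M a : Fin N → ℝ)
    (mo : Fin N → lorentzGroup × E4)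
    (Ψ : ∀ i, boostedKerrExterior (mo i).1 (mo i).2 (M i) (a i) → 𝒟.carrier)
    (ρ : Fin N → ℝ → ℝ) (U₀ : Opens E4) (Ψ₀ : U₀ → 𝒟.carrier) (k : ℕ) (ε R' T τ : ℝ) : Prop :=
  ∀ s ∈ Set.Icc (0 : ℝ) T,
    𝒟.toSpacetime.deviationCk (Minkowski.backgroundOn U₀) Ψ₀ k (τ + s) ≤ ENNReal.ofReal ε ∧
      ∀ i, 𝒟.toSpacetime.truncDeviationCk
        (boostedKerrBackground (mo i).1 (mo i).2 (M i) (a i)) (Ψ i) k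
          (max R' (ρ i (τ + T) + R')) (τ + s) ≤ ENNReal.ofReal ε

/-- `HypW k 𝒟 N` (WINDOWED recurrence, re-gauged): a witness tuple satisfying `Frame`, with
monotone tube radii, in which for every radius `R′`, window length `T` and `ε > 0` the window
closeness `Window … k ε R′ T τ` holds at arbitrarily late `τ`. [cite: arXiv210408222, §1] -/
def HypW (k : ℕ) (𝒟 : VacuumCauchyDevelopment D) (N : ℕ) : Prop :=
  ∃ (O : Set 𝒟.carrier) (M a : Fin N → ℝ) (mo : Fin N → lorentzGroup × E4) (τ₀ : ℝ)
    (Ψ : ∀ i, boostedKerrExterior (mo i).1 (mo i).2 (M i) (a i) → 𝒟.carrier)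
    (ρ R : Fin N → ℝ → ℝ) (U₀ : Opens E4) (Ψ₀ : U₀ → 𝒟.carrier),
    Frame 𝒟 O M a mo τ₀ Ψ ρ R U₀ Ψ₀ ∧ (∀ i, Monotone (ρ i)) ∧
      ∀ R' T : ℝ, ∀ ε : ℝ, 0 < ε → ∃ᶠ τ in atTop, Window 𝒟 M a mo Ψ ρ U₀ Ψ₀ k ε R' T τ

/-- The lab position at lab time `τ` of the straight label world-line with motion
`m = (Λ, c)` (the line `c + s·Λe₀`): `pᵢ(τ)`. [cite: ONeill1983, Ch. 3  p. 55] -/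
def labPos (m : lorentzGroup × E4) (τ : ℝ) : E3 :=
  E4.spatial (m.2 + ((τ - m.2 0) / ((m.1 : E4 ≃L[ℝ] E4) (E4.basisVector 0) 0)) •
    (m.1 : E4 ≃L[ℝ] E4) (E4.basisVector 0))

/-- The reference form of the far shell centred at `b ∈ E3` at lab time `τ`, scale `ℓ`, in
`b`-centred coordinates `y = x − (0, b)`: the superposed boosted Kerr–Schild ansatz
`G = η + Σᵢ (g_{Kerr,i} − η)` of `RecedingKerr.background` with motions `Λᵢ = (mo i).1` and
centres `ξᵢ = pᵢ(τ) − b`. [cite: KlainermanSzeftel2023, §3.6] -/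
def refForm {N : ℕ} (M a : Fin N → ℝ) (mo : Fin N → lorentzGroup × E4) (τ ℓ : ℝ) (b : E3) :
    E4 → E4 →L[ℝ] E4 →L[ℝ] ℝ :=
  (RecedingKerr.background M a (fun i ↦ (mo i).1) (fun i ↦ labPos (mo i) τ - b) τ ℓ).bilin

/-- One chart's contribution to the far-shell flux: for a lab-coordinate deviation field `F`
(zero where the chart is not used), the square roots of the `r^p` good-derivative flux (b)
and of the `r^{-1-δ}` transversal flux (c) of `y ↦ F(y + (0, b))` through the far part
`RecedingKerr.farLayer … τ ℓ` of the `b`-centred hyperboloidal layer, commuted to order `k`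
(flat null frame `L = ∂₀ + ∂_r`, `L̲ = ∂₀ − ∂_r` about the centre `b`). [cite: DafermosRodnianski2010ICMP, §3] -/
def shellFlux {N : ℕ} (M a : Fin N → ℝ) (mo : Fin N → lorentzGroup × E4) (k : ℕ)
    (p δ τ ℓ : ℝ) (b : E3) (F : E4 → E4 →L[ℝ] E4 →L[ℝ] ℝ) : ℝ≥0∞ :=
  RecedingKerr.rpFlux M a (fun i ↦ (mo i).1) (fun i ↦ labPos (mo i) τ - b) τ ℓ k p
      (fun y ↦ F (y + E4.ofTimeSpace 0 b)) ^ (1 / 2 : ℝ) +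
    RecedingKerr.transversalFlux M a (fun i ↦ (mo i).1) (fun i ↦ labPos (mo i) τ - b) τ ℓ k δ
      (fun y ↦ F (y + E4.ofTimeSpace 0 b)) ^ (1 / 2 : ℝ)

/-- The flat chart's deviation `Ψ₀^* g − G(· − (0,b))` from the `b`-centred reference form, in
lab coordinates, extended by zero off `U₀`. [cite: arXiv210408222, §1] -/
def flatDev (𝒟 : VacuumCauchyDevelopment D) {N : ℕ} (M a : Fin N → ℝ)
    (mo : Fin N → lorentzGroup × E4) (U₀ : Opens E4) (Ψ₀ : U₀ → 𝒟.carrier) (τ ℓ : ℝ)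
    (b : E3) : E4 → E4 →L[ℝ] E4 →L[ℝ] ℝ :=
  𝒟.toSpacetime.deviationExtend
    { domain := U₀
      bilin := fun x ↦ refForm M a mo τ ℓ b (x - E4.ofTimeSpace 0 b)
      time := fun x ↦ x 0
      radius := E4.spatialNorm } Ψ₀

/-- Hole chart `j`'s deviation `Ψⱼ^* g − G(· − (0,b))` from the `b`-centred reference form, in
lab coordinates, RESTRICTED to the label tube `{rⱼ < ρⱼ(x⁰)}` (indicator) and extended by zero
off the boosted exterior of hole `j`. [cite: arXiv210408222, §1] -/
def holeDev (𝒟 : VacuumCauchyDevelopment D) {N : ℕ} (M a : Fin N → ℝ)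
    (mo : Fin N → lorentzGroup × E4)
    (Ψ : ∀ i, boostedKerrExterior (mo i).1 (mo i).2 (M i) (a i) → 𝒟.carrier)
    (ρ : Fin N → ℝ → ℝ) (j : Fin N) (τ ℓ : ℝ) (b : E3) : E4 → E4 →L[ℝ] E4 →L[ℝ] ℝ :=
  Set.indicator {x : E4 | Kerr.radius (a j) (poincareInv (mo j).1 (mo j).2 x) < ρ j (x 0)}
    (𝒟.toSpacetime.deviationExtend
      { domain := boostedKerrExterior (mo j).1 (mo j).2 (M j) (a j)
        bilin := fun x ↦ refForm M a mo τ ℓ b (x - E4.ofTimeSpace 0 b)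
        time := fun x ↦ x 0
        radius := E4.spatialNorm } (Ψ j))

/-- `farFlux … k p δ τ ℓ b`: the FAR-SHELL FLUX of the atlas through the outgoing hyperboloidal
shell of scale `ℓ` erected at lab time `τ` about the centre `b` — the flat chart's contribution
on `U₀` plus every hole chart's contribution inside its own label tube (the pieces cover the
far shell by clause (6) of `Frame`; overlaps only add). Meaningful when every hole is CENTRAL
in the shell (`‖pⱼ(τ) − b‖ + 16Mⱼ ≤ ℓ/2`, the guard under which `HypL` asserts its smallness):
then the shell `{ℓ ≤ |y̲|}` stays outside every horizon, meets the tubes only at retarded times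
inside the window, and reads every hole's outgoing radiation as outgoing. [cite: DafermosRodnianski2010ICMP, §3] -/
def farFlux (𝒟 : VacuumCauchyDevelopment D) {N : ℕ} (M a : Fin N → ℝ)
    (mo : Fin N → lorentzGroup × E4)
    (Ψ : ∀ i, boostedKerrExterior (mo i).1 (mo i).2 (M i) (a i) → 𝒟.carrier)
    (ρ : Fin N → ℝ → ℝ) (U₀ : Opens E4) (Ψ₀ : U₀ → 𝒟.carrier) (k : ℕ) (p δ τ ℓ : ℝ)
    (b : E3) : ℝ≥0∞ :=
  shellFlux M a mo k p δ τ ℓ b (flatDev 𝒟 M a mo U₀ Ψ₀ τ ℓ b) +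
    ∑ j, shellFlux M a mo k p δ τ ℓ b (holeDev 𝒟 M a mo Ψ ρ j τ ℓ b)

/-- `HypL k p δ 𝒟 N` (manufactured LAYER smallness, re-gauged): a witness tuple satisfying
`Frame`, with monotone tube radii, in which for every layer scale `ℓ > 0`, radius `R′` and
`ε > 0`, at arbitrarily late `τ` BOTH the window closeness on `[τ, τ + 4ℓ]` (the near data, in
`Cᵏ` sup, out to `ρᵢ(τ + 4ℓ) + R′`) AND, for every centre `b ∈ E3` about which all holes are
central at scale `ℓ` (`‖pⱼ(τ) − b‖ + 16Mⱼ ≤ ℓ/2`; void for no `b` when `N = 0`, `b` near the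
hole when `N = 1`, and — deliberately — NO late `b` once `N ≥ 2` holes have separated beyond
`ℓ`, where a single-centred flat-frame shell would mis-weight the other holes' outgoing
radiation as incoming with weight `d^p`, card (4)), the far-shell flux bound
`farFlux … k p δ τ ℓ b ≤ ε` hold — one-time (indeed recurrent) smallness of the late layer in
the directional norm with the `r^p` weight on the incoming derivative only. [cite: DafermosRodnianski2010ICMP, §3] -/
def HypL (k : ℕ) (p δ : ℝ) (𝒟 : VacuumCauchyDevelopment D) (N : ℕ) : Prop :=
  ∃ (O : Set 𝒟.carrier) (M a : Fin N → ℝ) (mo : Fin N → lorentzGroup × E4) (τ₀ : ℝ)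
    (Ψ : ∀ i, boostedKerrExterior (mo i).1 (mo i).2 (M i) (a i) → 𝒟.carrier)
    (ρ R : Fin N → ℝ → ℝ) (U₀ : Opens E4) (Ψ₀ : U₀ → 𝒟.carrier),
    Frame 𝒟 O M a mo τ₀ Ψ ρ R U₀ Ψ₀ ∧ (∀ i, Monotone (ρ i)) ∧
      ∀ ℓ : ℝ, 0 < ℓ → ∀ R' : ℝ, ∀ ε : ℝ, 0 < ε → ∃ᶠ τ in atTop,
        Window 𝒟 M a mo Ψ ρ U₀ Ψ₀ k ε R' (4 * ℓ) τ ∧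
          ∀ b : E3, (∀ j, ‖labPos (mo j) τ - b‖ + 16 * M j ≤ ℓ / 2) →
            farFlux 𝒟 M a mo Ψ ρ U₀ Ψ₀ k p δ τ ℓ b ≤ ENNReal.ofReal ε

/-- `SettlesExt 𝒟` ("the exterior settles"): the DECOMPOSITION conjunct of the conclusion of
`RecurrentMultiKerrCapture` (and of the Statement), VERBATIM — a `C²` sub-extremal multi-Kerr
`FinalStateDecomposition` of the self-determined exterior with exhaustive charts. (The landed
`Theorems.ClusterCompleteness.Settles` of `ClusterCompletenessOmegaLimitMultiKerrDefs` is
`HasCompleteNullInfinity ∧` this; the dead line wrote it `Settles₂`.) [cite: DafermosLuk2017, Conjecture 1] -/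
def SettlesExt (𝒟 : VacuumCauchyDevelopment D) : Prop :=
  ∃ (O : Set 𝒟.carrier) (d : FinalStateDecomposition 𝒟.toSpacetime O 2),
    (∀ i, Kerr.IsSubextremal (d.mass i) (d.spin i)) ∧
      O = Summit.FinalStateConjecture.exteriorOf 𝒟.toCauchyDevelopment d.charted ∧
        Summit.FinalStateConjecture.HasExhaustiveCharts d

end Interface

/-! ### Read-back (re-bracketing only): `Hyp` IS the hypothesis of X with `N` explicit -/

section ReadBack

variable {X : Type} [TopologicalSpace X] [ChartedSpace E3 X] [IsManifold (𝓡 3) ∞ X]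
  [ConnectedSpace X] {D : InitialDataSet (𝓡 3) X}

/-- `Recurs k 𝒟` (the matrix of X's hypothesis, `ClusterCompletenessOmegaLimitMultiKerrDefs`) is EXACTLY
"for some hole count `N`, `Hyp k 𝒟 N`" (`Frame` = clauses (1)–(10), `RecurClause` = clause (11)). -/
theorem recurs_iff_exists_hyp (k : ℕ) (𝒟 : VacuumCauchyDevelopment D) :
    Recurs k 𝒟 ↔ ∃ N : ℕ, Hyp k 𝒟 N := by
  constructor
  · rintro ⟨O, N, M, a, mo, τ₀, Ψ, ρ, R, U₀, Ψ₀, h₁, h₂, h₃, h₄, h₅, h₆, h₇, h₈, h₉, h₁₀, h₁₁⟩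
    exact ⟨N, O, M, a, mo, τ₀, Ψ, ρ, R, U₀, Ψ₀, ⟨h₁, h₂, h₃, h₄, h₅, h₆, h₇, h₈, h₉, h₁₀⟩, h₁₁⟩
  · rintro ⟨N, O, M, a, mo, τ₀, Ψ, ρ, R, U₀, Ψ₀, ⟨h₁, h₂, h₃, h₄, h₅, h₆, h₇, h₈, h₉, h₁₀⟩, h₁₁⟩
    exact ⟨O, N, M, a, mo, τ₀, Ψ, ρ, R, U₀, Ψ₀, h₁, h₂, h₃, h₄, h₅, h₆, h₇, h₈, h₉, h₁₀, h₁₁⟩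

/-- The landed `Settles 𝒟` (`ClusterCompletenessOmegaLimitMultiKerrDefs`) is `HasCompleteNullInfinity ∧ SettlesExt`
(definitional). -/
theorem settles_iff_cni_and_settlesExt (𝒟 : VacuumCauchyDevelopment D) :
    Settles 𝒟 ↔ Summit.FinalStateConjecture.HasCompleteNullInfinity 𝒟.toCauchyDevelopment ∧ SettlesExt 𝒟 :=
  Iff.rfl

end ReadBack

/-! ### Tightness (projections; moved verbatim from the skeleton) -/

section Tightness

variable {X : Type} [TopologicalSpace X] [ChartedSpace E3 X] [IsManifold (𝓡 3) ∞ X]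
  [ConnectedSpace X] {D : InitialDataSet (𝓡 3) X} {𝒟 : VacuumCauchyDevelopment D} {N : ℕ}

/-- `Hyp` is antitone in the order (the deviations are monotone in `k`). -/
theorem hyp_mono {k k' : ℕ} (hk : k ≤ k') (h : Hyp k' 𝒟 N) : Hyp k 𝒟 N := by
  obtain ⟨O, M, a, mo, τ₀, Ψ, ρ, R, U₀, Ψ₀, hF, hrec⟩ := h
  refine ⟨O, M, a, mo, τ₀, Ψ, ρ, R, U₀, Ψ₀, hF, fun R' ε hε ↦ (hrec R' ε hε).mono ?_⟩
  intro τ hτ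
  exact ⟨(𝒟.toSpacetime.deviationCk_mono (Minkowski.backgroundOn U₀) Ψ₀ hk τ).trans hτ.1,
    fun i ↦ (supCkENorm_mono_right _ hk _).trans (hτ.2 i)⟩

/-- `HypCollar k → Hyp k`: the collar radius `max R′ (ρᵢ τ + R′)` is at least `R′`. -/
theorem hyp_of_hypCollar {k : ℕ} (h : HypCollar k 𝒟 N) : Hyp k 𝒟 N := by
  obtain ⟨O, M, a, mo, τ₀, Ψ, ρ, R, U₀, Ψ₀, hF, hrec⟩ := h
  refine ⟨O, M, a, mo, τ₀, Ψ, ρ, R, U₀, Ψ₀, hF, fun R' ε hε ↦ (hrec R' ε hε).mono ?_⟩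
  intro τ hτ
  exact ⟨hτ.1, fun i ↦ (𝒟.toSpacetime.truncDeviationCk_mono
    (boostedKerrBackground (mo i).1 (mo i).2 (M i) (a i)) (Ψ i) k (le_max_left _ _) τ).trans
      (hτ.2 i)⟩

/-- `HypW k → Hyp k`: the window of length `T := 0` at `s = 0`. -/
theorem hyp_of_hypW {k : ℕ} (h : HypW k 𝒟 N) : Hyp k 𝒟 N := by
  obtain ⟨O, M, a, mo, τ₀, Ψ, ρ, R, U₀, Ψ₀, hF, _hmono, hW⟩ := h
  refine ⟨O, M, a, mo, τ₀, Ψ, ρ, R, U₀, Ψ₀, hF, fun R' ε hε ↦ (hW R' 0 ε hε).mono ?_⟩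
  intro τ hτ
  have h0 := hτ 0 (Set.left_mem_Icc.mpr le_rfl)
  simp only [add_zero] at h0
  exact ⟨h0.1, fun i ↦ (𝒟.toSpacetime.truncDeviationCk_mono
    (boostedKerrBackground (mo i).1 (mo i).2 (M i) (a i)) (Ψ i) k (le_max_left _ _) τ).trans
      (h0.2 i)⟩

/-- `HypL k p δ → Hyp k`: the layer clause at `ℓ := 1`, window at `s = 0`. -/
theorem hyp_of_hypL {k : ℕ} {p δ : ℝ} (h : HypL k p δ 𝒟 N) : Hyp k 𝒟 N := by
  obtain ⟨O, M, a, mo, τ₀, Ψ, ρ, R, U₀, Ψ₀, hF, _hmono, hL⟩ := h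
  refine ⟨O, M, a, mo, τ₀, Ψ, ρ, R, U₀, Ψ₀, hF, fun R' ε hε ↦ (hL 1 one_pos R' ε hε).mono ?_⟩
  intro τ hτ
  have h0 := hτ.1 0 (Set.left_mem_Icc.mpr (by norm_num))
  simp only [add_zero] at h0
  exact ⟨h0.1, fun i ↦ (𝒟.toSpacetime.truncDeviationCk_mono
    (boostedKerrBackground (mo i).1 (mo i).2 (M i) (a i)) (Ψ i) k (le_max_left _ _) τ).trans
      (h0.2 i)⟩

end Tightness

end Summit.FinalStateConjecture.FinalStateConjecture.Theorems.ClusterCompleteness.IncomingFromThePast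

end
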